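import Summits.HodgeConjecture.CorCM.MultiFieldWeilMarkman22
import Literature.AlgebraicGeometry.HodgeTheory.WeilTypeHodgeRing
import HarnessLib

/-!
# MULTI-FIELD WEIL ENGINE — the Weil-space input `hW` for a slot of CURVE MULTIPLICITY `c = 0` and HALF-DIMENSION `3`: a CM SIXFOLD of `k`-signature `(3,3)` over a
# DODECIC field, ITS OWN Weil plane algebraic GIVEN Markman's hyperbolic-sixfold theorem AND an honest HYPERBOLICITY hypothesis on the slot

Cell `pub-hodgecm2` (COR-CM), seat b30 gen 43 (2026-08-26); count-neutral own lane MULTI-FIELD WEIL ENGINE (stem `MultiFieldWeil*`), the `c = 0`, `w = 3` companion of gen 29's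
`CorCM/MultiFieldWeilMarkman22.lean` (`c = 0`, `w = 2`: an octic `(2,2)`-slot from Markman's FOURFOLD theorem, no discriminant condition).  In half-dimension `3` Markman's theorem
(arXiv:2502.03415 Thm 1.5.1, `HodgeTheory.Markman2025_weilClasses_algebraic_hyperbolicSixfold`) asks the pair `(X, φ)` to be HYPERBOLIC (discriminant `−1`) for some
`K`-symmetrised hyperplane class; for the slots `B × E` (decic `(2,3)`) and `B × E × E` (octic `(1,3)`) of the menus this is automatic (an odd-dimensional factor times a curve, ring 2),
but for a SIXFOLD ALONE it is a genuine arithmetic condition on the polarised pair — so it is DISPLAYED here as a hypothesis, never discharged.  Theorems only; no definition, no named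
fact of its own, no `sorry`.  HONEST FRAMING: conditional on the displayed Markman binder AND on the displayed hyperbolicity datum; `HC_CM` is NOT asserted.

* §1 **`weilClassesOf_le_algebraicClasses_of_markman_hyperbolicSixfold`** (any complex abelian sixfold `X`, `φ² = −d`): a hyperbolic `K`-symmetrised hyperplane class makes
  `(X, φ)` of Weil type `(3, d)` (`isWeilType_of_isHyperbolicWeilType`, Deligne–van Geemen), the plane is spanned by its rational `(3,3)` classes
  (`IsWeilType.weilClassesOf_le_algebraicClasses`, van Geemen 4.9), and those are algebraic by Markman's theorem: the WHOLE complex Weil plane `W_K(X) ⊗ ℂ` is algebraic.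
* §2 **`weilHyp_of_markman_sixfold_hyperbolic`** — the ENGINE INPUT `hW m` of `MultiFieldWeil.hodgeConjectureFor_biproduct_comp_of_defectLawG` (and of every units ∕ separated ∕
  commutant headline) for a slot `B_m ⊨ (K_m; Φ)` with `[K_m : ℚ] = 12` and THREE type members over `τ` (`n = 6`, `p = 3`, `c = 6 − 2·3 = 0`, `w = 6 − 3 = 3`): the part is the
  one-slot product `⨁_{Fin 1} B_m` with `φ = ι_{B_m}(i_m δ)` (`δ² = −d`), and the hypothesis is a hyperbolicity datum `(e, a)` FOR THAT PAIR.  This opens the DODECIC `(3,3)` slot to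
  the menus (successor: the headline needs the single-slot menu extended by `2`-transitivity ∕ `3`-homogeneity of the sextic part, and `hunit` by U1 for several structures).
[cite: Markman2025SecantWeil, Thm 1.5.1 and §1.1] [cite: Deligne1982HodgeCycles, proof of Thm. 4.8 with Prop. 4.4] [cite: vanGeemen1994HodgeAV, 4.9, Lemma 5.2 (1) and 5.4]
[cite: Milne2020HodgeClassesAV, 1.2 (a)]

## References
* [Markman2025SecantWeil] E. Markman, Cycles on abelian 2n-folds of Weil type from secant sheaves on abelian n-folds, arXiv:2502.03415, Thm 1.5.1, §1.1 (unrefereed).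
* [Deligne1982HodgeCycles] P. Deligne, LNM 900 (1982), §4 Prop. 4.4 and proof of Thm. 4.8.  [vanGeemen1994HodgeAV] B. van Geemen, LNM 1594 (1994), 4.9, Lemma 5.2, 5.4.
  [Milne2020HodgeClassesAV] J. S. Milne, arXiv:2010.08857, 1.2 (a).
-/

noncomputable section

open CategoryTheory CategoryTheory.Limits NumberField

namespace Summit.HodgeConjecture.CorCM.MultiFieldWeil

open Literature.AlgebraicGeometry Literature.AlgebraicGeometry.Motives Literature.AlgebraicGeometry.HodgeTheory
open Literature.AlgebraicGeometry.ComplexMultiplication (IsCMTypeRealisation)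
open Literature.AlgebraicTopology.SingularHomology
open Literature.NumberTheory.ComplexMultiplication
open Summit.HodgeConjecture.CorCM.CMWeights (sum_finrank_eq_two_mul_dim biproduct_map_comp_self_eq_neg)

open scoped Classical

/-! ## §1 A hyperbolic sixfold: the whole Weil plane is algebraic given Markman -/

/-- **THE WHOLE WEIL PLANE OF A HYPERBOLIC SIXFOLD IS ALGEBRAIC, GIVEN MARKMAN'S THEOREM.**  `X` a complex abelian sixfold, `φ² = −d` (`d ≥ 1`), and a hyperbolicity datum: a
projective embedding `e` and a non-zero rational class `a` on the projective space with `(X, φ)` hyperbolic for `h = d·e^*a + φ^*e^*a`.  Then `(X, φ)` is of Weil type `(3, d)` and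
`weilClassesOf X φ 3 d ≤ algebraicClasses X 3`. [cite: Markman2025SecantWeil, Thm 1.5.1] [cite: Deligne1982HodgeCycles, proof of Thm. 4.8 with Prop. 4.4]
[cite: vanGeemen1994HodgeAV, 4.9, Lemma 5.2 (1) and 5.4] -/
theorem weilClassesOf_le_algebraicClasses_of_markman_hyperbolicSixfold (hM6 : Markman2025_weilClasses_algebraic_hyperbolicSixfold)
    {X : AbelianVariety ℂ} {φ : X ⟶ X} {d : ℕ} (hd : 0 < d) (hdim : X.dim = 2 * 3) (hφ : φ ≫ φ = -(d • 𝟙 X))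
    (e : ProjectiveEmbedding X.X) {a : complexBetti (projectiveSpace e.n ℂ) 2} (ha : IsRationalClass a) (ha0 : a ≠ 0)
    (hhyp : IsHyperbolicWeilType X φ 3 ((d : ℂ) • complexBetti.map e.ι 2 a + complexBetti.map φ.hom.hom.hom 2 (complexBetti.map e.ι 2 a))) :
    weilClassesOf X φ 3 d ≤ algebraicClasses X.X 3 :=
  (isWeilType_of_isHyperbolicWeilType (by norm_num) hd hdim hφ e ha ha0 hhyp).weilClassesOf_le_algebraicClasses fun c hcW hcQ hcH =>
    hM6 d hd X φ hdim (by rw [← hdim]; exact AbelianVariety.isSmoothProjective_holds) hφ e a ha ha0 hhyp c hcQ hcH hcW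

/-! ## §2 The engine input for a dodecic `(3,3)`-slot (`c = 0`, `w = 3`), given the hyperbolicity of the slot -/

section Slot

variable {I : Type} {r : ℕ} {Kf : I → Type} [∀ i, Field (Kf i)] [∀ i, NumberField (Kf i)]
  {i₀ : I} {is : Fin r → I} {τ : Kf i₀ →+* ℂ} {im : ∀ m : Fin r, Kf i₀ →+* Kf (is m)}
  {A : Fin (r + 1) → AbelianVariety ℂ} {Φ : ∀ j : Fin (r + 1), CMType (Kf (mfSlots i₀ is j))}
  {ι : ∀ j, 𝓞 (Kf (mfSlots i₀ is j)) →+* End (A j)}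
  {θ : ∀ j, Kf (mfSlots i₀ is j) →+* Module.End ℂ (complexBetti (A j).X 1)}
  {δ : 𝓞 (Kf i₀)} {d : ℕ}

/-- The one-slot part `⨁_{Fin 1} B_m` (`partSlots 0 m`) has dimension `6` when `[K_m : ℚ] = 12`. [folklore] -/
theorem dim_biproduct_partSlots_zero_eq_six (m : Fin r) (hA : ∀ j, IsCMTypeRealisation (Φ j) (A j) (ι j) (θ j))
    (h12 : Module.finrank ℚ (Kf (is m)) = 12) : (⨁ fun j : Fin 1 => A (partSlots 0 m j)).dim = 2 * 3 := by
  have h := sum_finrank_eq_two_mul_dim (K := fun j : Fin 1 => Kf (mfSlots i₀ is (partSlots 0 m j))) (fun j => hA (partSlots 0 m j))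
  rw [Fin.sum_univ_one] at h
  change Module.finrank ℚ (Kf (is m)) = _ at h
  omega

omit [∀ i, NumberField (Kf i)] in
/-- `φ = ι(i_m δ)` on the one-slot part squares to `−d`. [folklore] -/
theorem biproduct_map_partSlots_zero_comp_self (m : Fin r) (hδ : ((δ : Kf i₀)) ^ 2 = -(d : Kf i₀)) :
    (biproduct.map fun j : Fin 1 => ι (partSlots 0 m j) (δfam im δ (partSlots 0 m j))) ≫
      (biproduct.map fun j : Fin 1 => ι (partSlots 0 m j) (δfam im δ (partSlots 0 m j))) = -(d • 𝟙 (⨁ fun j : Fin 1 => A (partSlots 0 m j))) := by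
  have hδ𝓞 : δ ^ 2 = -(d : 𝓞 (Kf i₀)) := by
    apply RingOfIntegers.ext
    change algebraMap (𝓞 (Kf i₀)) (Kf i₀) (δ ^ 2) = algebraMap (𝓞 (Kf i₀)) (Kf i₀) (-(d : 𝓞 (Kf i₀)))
    rw [map_pow, map_neg, map_natCast]
    exact hδ
  have ha : ∀ j : Fin 1, δfam im δ (partSlots 0 m j) * δfam im δ (partSlots 0 m j) = -(d : 𝓞 (Kf (mfSlots i₀ is (partSlots 0 m j)))) := by
    intro j
    obtain rfl : j = 0 := Subsingleton.elim _ _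
    change RingOfIntegers.mapRingHom (im m) δ * RingOfIntegers.mapRingHom (im m) δ = -(d : 𝓞 (Kf (is m)))
    rw [← map_mul, ← sq, hδ𝓞, map_neg, map_natCast]
  exact biproduct_map_comp_self_eq_neg (A := fun j : Fin 1 => A (partSlots 0 m j)) (ι := fun j => ι (partSlots 0 m j))
    (fun j => δfam im δ (partSlots 0 m j)) ha

/-- **ENGINE INPUT — a DODECIC `(3,3)`-slot (`n = 6`, three members over `τ`, `c = 0`, `w = 3`), GIVEN Markman's hyperbolic-sixfold theorem AND the hyperbolicity of the slot**:
the Weil plane of the part `⨁_i A(partSlots 0 m i) = ⨁_{Fin 1} B_m` for `φ = ι(i_m δ)` is algebraic.  The hypothesis `hW m` of `MultiFieldWeil.hodgeConjectureFor_biproduct_comp_of_defectLawG`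
for such a slot; the hyperbolicity datum `(e, a, hhyp)` is an HONEST displayed hypothesis on the one-slot pair. [cite: Markman2025SecantWeil, Thm 1.5.1 and §1.1]
[cite: vanGeemen1994HodgeAV, 4.9, Lemma 5.2 (1) and 5.4] -/
theorem weilHyp_of_markman_sixfold_hyperbolic (hM6 : Markman2025_weilClasses_algebraic_hyperbolicSixfold) (m : Fin r)
    (h12 : Module.finrank ℚ (Kf (is m)) = 12) (hd : 0 < d) (hδ : ((δ : Kf i₀)) ^ 2 = -(d : Kf i₀))
    (hA : ∀ j, IsCMTypeRealisation (Φ j) (A j) (ι j) (θ j))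
    (e : ProjectiveEmbedding (⨁ fun j : Fin 1 => A (partSlots 0 m j)).X) {a : complexBetti (projectiveSpace e.n ℂ) 2} (ha : IsRationalClass a) (ha0 : a ≠ 0)
    (hhyp : IsHyperbolicWeilType (⨁ fun j : Fin 1 => A (partSlots 0 m j)) (biproduct.map fun j : Fin 1 => ι (partSlots 0 m j) (δfam im δ (partSlots 0 m j))) 3
      ((d : ℂ) • complexBetti.map e.ι 2 a +
        complexBetti.map (biproduct.map fun j : Fin 1 => ι (partSlots 0 m j) (δfam im δ (partSlots 0 m j))).hom.hom.hom 2 (complexBetti.map e.ι 2 a))) :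
    weilClassesOf (⨁ fun i => A (partSlots 0 m i)) (biproduct.map fun i => ι (partSlots 0 m i) (δfam im δ (partSlots 0 m i))) 3 d ≤
      algebraicClasses (⨁ fun i => A (partSlots 0 m i)).X 3 :=
  weilClassesOf_le_algebraicClasses_of_markman_hyperbolicSixfold hM6 hd (dim_biproduct_partSlots_zero_eq_six m hA h12)
    (biproduct_map_partSlots_zero_comp_self (A := A) (ι := ι) m hδ) e ha ha0 hhyp

end Slot

end Summit.HodgeConjecture.CorCM.MultiFieldWeil

end
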